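import Summits.HubbardSuperconductivity.HubbardSuperconductivity.Theorems.AnisotropyChordTransferFibre3FinXDCheck

/-!
# Route `AnisotropyChord` / H0 rotor rung: FIN per-`L` row-D (KT-2a″) cell facts, `L = 10`, cells 150–154

Kernel facts `xdCellAny0 10 (49/50) la lb aD = true` (in-kernel point tables, zero data; `decide +kernel`) for the combined-cell
grid of `L = 10` (g5 design, 1–2.5 % cells); assembled in `…FinXDTen`.  Prover seat `hubbard-h0-rotor-p3` g7; helper for piece A =
stmt-HubbardSuperconductivity-23918 of rung 19089 (`--supports`, helper class).  WHAT THIS IS NOT: nothing here proves superconductivity in the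
Hubbard model (rotor TARGET as worded stays FALSE, g15 verdict); kernel facts for ONE hypothesis of ONE conditional reduction.  No sorry.
-/

set_option linter.dupNamespace false
set_option autoImplicit false

namespace Summit.HubbardSuperconductivity.HubbardSuperconductivity.Theorems.AnisotropyChord.Transfer.Fibre3

namespace FinXD

/-- cell 150 of `L = 10` (`cert`). [folklore] -/
theorem xd10_150 : xdCellAny0 10 (49/50 : ℚ) 21863072870414625 22125429744859601 (1/20 : ℚ) = true := by decide +kernel

/-- cell 151 of `L = 10` (`cert`). [folklore] -/
theorem xd10_151 : xdCellAny0 10 (49/50 : ℚ) 22125429744859601 22390934901797917 (1/20 : ℚ) = true := by decide +kernel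

/-- cell 152 of `L = 10` (`cert`). [folklore] -/
theorem xd10_152 : xdCellAny0 10 (49/50 : ℚ) 22390934901797917 22659626120619493 (1/20 : ℚ) = true := by decide +kernel

/-- cell 153 of `L = 10` (`cert`). [folklore] -/
theorem xd10_153 : xdCellAny0 10 (49/50 : ℚ) 22659626120619493 22931541634066929 (1/20 : ℚ) = true := by decide +kernel

/-- cell 154 of `L = 10` (`cert`). [folklore] -/
theorem xd10_154 : xdCellAny0 10 (49/50 : ℚ) 22931541634066929 23206720133675733 (1/20 : ℚ) = true := by decide +kernel

end FinXD

end Summit.HubbardSuperconductivity.HubbardSuperconductivity.Theorems.AnisotropyChord.Transfer.Fibre3
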